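import Mathlib.NumberTheory.Padics.PadicVal.Basic
import Mathlib.FieldTheory.Finite.Basic
import HarnessLib

/-!
# Route `ResidualThetaTransportAtTwo`, node 27436 (cruxes Kan⁺ stmt-BirchSwinnertonDyer-20688 / 21437): HENSEL LIFTING for the
# powers of `4` modulo `q^t` (`q` an odd prime) — the arithmetic input of the `q`-adic triangles

Cell `bsd-wall`, width seat `bsd-wall-rtt-p3-w2` g4 (2026-08-28). THEOREMS ONLY (pure arithmetic, no `χ`);
`--supports stmt-BirchSwinnertonDyer-20688`; BSD is not proved by this.

MAIN (`exists_hensel_four`): for every odd prime `q` there is `e ≥ 1` with `q^e ∣ 4^{q−1} − 1` such that for all `t` and every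
integer `x ≡ 1 (mod q^{min(e,t)})` some `k ≥ 1` has `q^t ∣ 4^k − x`. (`e := v_q(4^{q−1} − 1)`; `4^{(q−1)q^j} = 1 + q^{e+j}c_j` with
`q ∤ c_j` by the binomial theorem to third order; then lift one `q`-adic digit at a time.) In words: the subgroup `⟨4⟩` of
`(ℤ/q^t)ˣ` contains every class `≡ 1 (mod q^e)` — for a non-Wieferich `q` (`e = 1`) every class `≡ 1 (mod q)`.
The sequel `…CuspSpanRuleQ` uses it to place the upper-right entry of a product of two `B₁`-elements in `−⟨4⟩` modulo its
lower-right entry `−q^t`.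

References: K. Hensel (lifting); [Rademacher1929] §1; [Pollack2003] Conj. 6.3 (the node these files serve).
-/

set_option autoImplicit false
set_option linter.dupNamespace false

namespace Summit.BirchSwinnertonDyer.BirchSwinnertonDyer.Theorems.SignedMuAtTwo

/-! ## §1. Binomial theorem to third order -/

/-- `(1 + X)^n = 1 + nX + C(n,2) X² + X³ S` for some integer `S`. [folklore] -/
theorem exists_one_add_pow_eq_third_order (X : ℤ) (n : ℕ) :
    ∃ S : ℤ, (1 + X) ^ n = 1 + n * X + (n.choose 2 : ℕ) * X ^ 2 + X ^ 3 * S := by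
  induction n with
  | zero => exact ⟨0, by simp⟩
  | succ n ih =>
    obtain ⟨S, hS⟩ := ih
    refine ⟨S + (n.choose 2 : ℕ) + X * S, ?_⟩
    have hc : ((n + 1).choose 2 : ℕ) = n + n.choose 2 := by
      rw [Nat.choose_succ_succ, Nat.choose_one_right]
    rw [pow_succ, hS, hc]
    push_cast
    ring

/-- `(1 + X)^n = 1 + nX + X² R` for some integer `R`. [folklore] -/
theorem exists_one_add_pow_eq_second_order (X : ℤ) (n : ℕ) :
    ∃ R : ℤ, (1 + X) ^ n = 1 + n * X + X ^ 2 * R := by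
  obtain ⟨S, hS⟩ := exists_one_add_pow_eq_third_order X n
  exact ⟨(n.choose 2 : ℕ) + X * S, by rw [hS]; ring⟩

/-- For odd `q`: `C(q, 2) = q · ((q − 1)/2)`. [folklore] -/
theorem choose_two_eq_mul_half {q : ℕ} (hq : q % 2 = 1) : q.choose 2 = q * ((q - 1) / 2) := by
  rw [Nat.choose_two_right]
  obtain ⟨h, hh⟩ : ∃ h, q - 1 = 2 * h := ⟨(q - 1) / 2, by omega⟩
  rw [hh, Nat.mul_div_cancel_left h (by norm_num : 0 < 2), show q * (2 * h) = q * h * 2 by ring,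
    Nat.mul_div_cancel _ (by norm_num : 0 < 2)]

/-! ## §2. The exact power of `q` in `4^{(q−1)q^j} − 1` -/

/-- If `4^M = 1 + q^{E+1} c` with `q ∤ c` (`q` an odd prime), then `4^{Mq} = 1 + q^{E+2} c'` with `q ∤ c'`. [folklore] -/
theorem four_pow_mul_prime_step {q : ℕ} (hq : q.Prime) (hq2 : q ≠ 2) (M E : ℕ) (c : ℤ)
    (h : (4 : ℤ) ^ M = 1 + (q : ℤ) ^ (E + 1) * c) (hc : ¬ (q : ℤ) ∣ c) :
    ∃ c' : ℤ, (4 : ℤ) ^ (M * q) = 1 + (q : ℤ) ^ (E + 2) * c' ∧ ¬ (q : ℤ) ∣ c' := by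
  have hqodd : q % 2 = 1 := Nat.odd_iff.mp (hq.eq_two_or_odd'.resolve_left hq2)
  set X : ℤ := (q : ℤ) ^ (E + 1) * c with hX
  obtain ⟨S, hS⟩ := exists_one_add_pow_eq_third_order X q
  have hch : ((q.choose 2 : ℕ) : ℤ) = (q : ℤ) * (((q - 1) / 2 : ℕ) : ℤ) := by
    rw [choose_two_eq_mul_half hqodd]; push_cast; ring
  refine ⟨c + (q : ℤ) * ((((q - 1) / 2 : ℕ) : ℤ) * (q : ℤ) ^ E * c ^ 2 + (q : ℤ) ^ (2 * E) * c ^ 3 * S), ?_, ?_⟩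
  · rw [pow_mul, h, hS, hch, hX]
    ring
  · intro hdvd
    apply hc
    have : (q : ℤ) ∣ (q : ℤ) * ((((q - 1) / 2 : ℕ) : ℤ) * (q : ℤ) ^ E * c ^ 2 + (q : ℤ) ^ (2 * E) * c ^ 3 * S) :=
      dvd_mul_right _ _
    exact (dvd_add_left this).mp hdvd

/-- With `e = v_q(4^{q−1} − 1) = e₀ + 1`: `4^{(q−1)q^j} = 1 + q^{e+j} c_j` with `q ∤ c_j`, for every `j`. [folklore] -/
theorem four_pow_sub_one_exact {q : ℕ} (hq : q.Prime) (hq2 : q ≠ 2) (e₀ : ℕ) (c₀ : ℤ)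
    (h0 : (4 : ℤ) ^ (q - 1) = 1 + (q : ℤ) ^ (e₀ + 1) * c₀) (hc0 : ¬ (q : ℤ) ∣ c₀) (j : ℕ) :
    ∃ c : ℤ, (4 : ℤ) ^ ((q - 1) * q ^ j) = 1 + (q : ℤ) ^ (e₀ + j + 1) * c ∧ ¬ (q : ℤ) ∣ c := by
  induction j with
  | zero => exact ⟨c₀, by simpa using h0, hc0⟩
  | succ j ih =>
    obtain ⟨c, hc, hcn⟩ := ih
    obtain ⟨c', hc', hcn'⟩ := four_pow_mul_prime_step hq hq2 ((q - 1) * q ^ j) (e₀ + j) c hc hcn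
    refine ⟨c', ?_, hcn'⟩
    rw [pow_succ, ← mul_assoc, hc']
    ring_nf

/-! ## §3. Lifting -/

/-- One lifting step: from `q^{e+j} ∣ 4^k − x` (`k ≥ 1`) to `q^{e+j+1} ∣ 4^{k'} − x` (`k' ≥ 1`), using
`4^{(q−1)q^j} = 1 + q^{e+j}c`, `q ∤ c`. [folklore] -/
theorem hensel_four_step {q : ℕ} (hq : q.Prime) (hq2 : q ≠ 2) (e₀ j : ℕ) (c : ℤ)
    (hc : (4 : ℤ) ^ ((q - 1) * q ^ j) = 1 + (q : ℤ) ^ (e₀ + j + 1) * c) (hcn : ¬ (q : ℤ) ∣ c)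
    (x : ℤ) (k : ℕ) (hk : 1 ≤ k) (hkx : (q : ℤ) ^ (e₀ + j + 1) ∣ 4 ^ k - x) :
    ∃ k' : ℕ, 1 ≤ k' ∧ (q : ℤ) ^ (e₀ + j + 2) ∣ 4 ^ k' - x := by
  haveI : Fact q.Prime := ⟨hq⟩
  obtain ⟨y, hy⟩ := hkx
  -- choose `i` with `q ∣ y + i 4^k c`
  have h4 : (4 : ZMod q) ≠ 0 := by
    intro h0
    have h0' : ((4 : ℕ) : ZMod q) = 0 := by exact_mod_cast h0
    have h4 : q ∣ 2 ^ 2 := by norm_num; exact (ZMod.natCast_eq_zero_iff 4 q).mp h0'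
    exact hq2 ((Nat.prime_dvd_prime_iff_eq hq Nat.prime_two).mp (hq.dvd_of_dvd_pow h4))
  have hcq : ((c : ℤ) : ZMod q) ≠ 0 := by
    intro h0; exact hcn ((ZMod.intCast_zmod_eq_zero_iff_dvd c q).mp h0)
  have hunit : ((4 : ZMod q) ^ k * (c : ZMod q)) ≠ 0 := mul_ne_zero (pow_ne_zero _ h4) hcq
  set z : ZMod q := -((y : ℤ) : ZMod q) * ((4 : ZMod q) ^ k * (c : ZMod q))⁻¹ with hz
  set i : ℕ := z.val with hi
  have hiz : ((i : ℕ) : ZMod q) = z := by rw [hi]; exact ZMod.natCast_zmod_val z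
  have hqdvd : (q : ℤ) ∣ y + i * 4 ^ k * c := by
    rw [← ZMod.intCast_zmod_eq_zero_iff_dvd]
    push_cast
    rw [hiz, hz]
    field_simp
    ring
  obtain ⟨w, hw⟩ := hqdvd
  obtain ⟨R, hR⟩ := exists_one_add_pow_eq_second_order ((q : ℤ) ^ (e₀ + j + 1) * c) i
  refine ⟨k + i * ((q - 1) * q ^ j), by omega, ?_⟩
  refine ⟨w + (q : ℤ) ^ (e₀ + j) * 4 ^ k * c ^ 2 * R, ?_⟩
  rw [pow_add, pow_mul', hc, hR]
  -- `4^k (1 + iX + X²R) − x = q^{e+j}(y + i4^kc) + 4^k X² R`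
  linear_combination hy + (q : ℤ) ^ (e₀ + j + 1) * hw

/-- Lifting to all levels: for `x ≡ 1 (mod q^e)` and every `j`, some `k ≥ 1` has `q^{e+j} ∣ 4^k − x`. [folklore] -/
theorem hensel_four_lift {q : ℕ} (hq : q.Prime) (hq2 : q ≠ 2) (e₀ : ℕ) (c₀ : ℤ)
    (h0 : (4 : ℤ) ^ (q - 1) = 1 + (q : ℤ) ^ (e₀ + 1) * c₀) (hc0 : ¬ (q : ℤ) ∣ c₀)
    (x : ℤ) (hx : (q : ℤ) ^ (e₀ + 1) ∣ x - 1) (j : ℕ) :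
    ∃ k : ℕ, 1 ≤ k ∧ (q : ℤ) ^ (e₀ + 1 + j) ∣ 4 ^ k - x := by
  induction j with
  | zero =>
    refine ⟨q - 1, by have := hq.two_le; omega, ?_⟩
    rw [add_zero]
    have h1 : (q : ℤ) ^ (e₀ + 1) ∣ 4 ^ (q - 1) - 1 := ⟨c₀, by linear_combination h0⟩
    have := dvd_sub h1 hx
    simpa using this
  | succ j ih =>
    obtain ⟨k, hk, hkx⟩ := ih
    obtain ⟨c, hc, hcn⟩ := four_pow_sub_one_exact hq hq2 e₀ c₀ h0 hc0 j
    have hkx' : (q : ℤ) ^ (e₀ + j + 1) ∣ 4 ^ k - x := by rwa [show e₀ + j + 1 = e₀ + 1 + j by ring]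
    obtain ⟨k', hk', h'⟩ := hensel_four_step hq hq2 e₀ j c hc hcn x k hk hkx'
    exact ⟨k', hk', by rwa [show e₀ + 1 + (j + 1) = e₀ + j + 2 by ring]⟩

/-! ## §4. Packaging: the exponent `e` and the lifting property -/

/-- **Hensel for the powers of `4`.** For an odd prime `q` there is `e ≥ 1` with `q^e ∣ 4^{q−1} − 1` such that every integer
`x ≡ 1 (mod q^{min(e,t)})` is congruent to a positive power of `4` modulo `q^t`. [folklore] -/
theorem exists_hensel_four (q : ℕ) (hq : q.Prime) (hq2 : q ≠ 2) :
    ∃ e : ℕ, 1 ≤ e ∧ (q : ℤ) ^ e ∣ 4 ^ (q - 1) - 1 ∧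
      ∀ t : ℕ, ∀ x : ℤ, (q : ℤ) ^ (min e t) ∣ x - 1 → ∃ k : ℕ, 1 ≤ k ∧ (q : ℤ) ^ t ∣ 4 ^ k - x := by
  haveI : Fact q.Prime := ⟨hq⟩
  have hq1 : 2 ≤ q := hq.two_le
  -- `A := 4^{q−1} − 1` as a natural number; `q ∣ A` by Fermat
  set A : ℕ := 4 ^ (q - 1) - 1 with hA
  have hA1 : 1 ≤ 4 ^ (q - 1) := Nat.one_le_pow _ _ (by norm_num)
  have hAint : (A : ℤ) = 4 ^ (q - 1) - 1 := by rw [hA]; push_cast [Nat.cast_sub hA1]; ring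
  have h4 : (4 : ZMod q) ≠ 0 := by
    intro h0
    have h0' : ((4 : ℕ) : ZMod q) = 0 := by exact_mod_cast h0
    have h4 : q ∣ 2 ^ 2 := by norm_num; exact (ZMod.natCast_eq_zero_iff 4 q).mp h0'
    exact hq2 ((Nat.prime_dvd_prime_iff_eq hq Nat.prime_two).mp (hq.dvd_of_dvd_pow h4))
  have hqA : q ∣ A := by
    have h1 : (q : ℤ) ∣ (A : ℤ) := by
      rw [hAint, ← ZMod.intCast_zmod_eq_zero_iff_dvd]; push_cast
      rw [ZMod.pow_card_sub_one_eq_one h4, sub_self]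
    exact_mod_cast h1
  have hA0 : A ≠ 0 := by
    intro h0
    have : q ∣ 0 := h0 ▸ hqA
    have h41 : 4 ^ (q - 1) = 1 := by omega
    have : q - 1 = 0 := by
      by_contra hne
      have : 4 ≤ 4 ^ (q - 1) := by
        calc (4 : ℕ) = 4 ^ 1 := by norm_num
          _ ≤ 4 ^ (q - 1) := Nat.pow_le_pow_right (by norm_num) (by omega)
      omega
    omega
  have he1 : 1 ≤ padicValNat q A := one_le_padicValNat_of_dvd hA0 hqA
  set e₀ : ℕ := padicValNat q A - 1 with he₀
  have he : padicValNat q A = e₀ + 1 := by omega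
  have hdvd : q ^ (e₀ + 1) ∣ A := he ▸ pow_padicValNat_dvd
  have hndvd : ¬ q ^ (e₀ + 1 + 1) ∣ A := he ▸ pow_succ_padicValNat_not_dvd hA0
  obtain ⟨c₀, hc₀⟩ := hdvd
  have h0 : (4 : ℤ) ^ (q - 1) = 1 + (q : ℤ) ^ (e₀ + 1) * c₀ := by
    have := congrArg (Nat.cast : ℕ → ℤ) hc₀
    push_cast at this
    linear_combination -hAint + this
  have hc0 : ¬ (q : ℤ) ∣ (c₀ : ℤ) := by
    intro h
    obtain ⟨c₁, hc₁⟩ := Int.natCast_dvd_natCast.mp h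
    exact hndvd ⟨c₁, by rw [hc₀, hc₁]; ring⟩
  refine ⟨e₀ + 1, by omega, ⟨c₀, by linear_combination h0⟩, fun t x hx ↦ ?_⟩
  by_cases ht : t ≤ e₀ + 1
  · -- `t ≤ e`: `k = q − 1`
    rw [min_eq_right ht] at hx
    refine ⟨q - 1, by omega, ?_⟩
    have h1 : (q : ℤ) ^ t ∣ 4 ^ (q - 1) - 1 :=
      (pow_dvd_pow _ ht).trans ⟨c₀, by linear_combination h0⟩
    have := dvd_sub h1 hx
    simpa using this
  · rw [min_eq_left (by omega)] at hx
    obtain ⟨k, hk, h⟩ := hensel_four_lift hq hq2 e₀ c₀ h0 hc0 x hx (t - (e₀ + 1))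
    exact ⟨k, hk, by rwa [show e₀ + 1 + (t - (e₀ + 1)) = t by omega] at h⟩

end Summit.BirchSwinnertonDyer.BirchSwinnertonDyer.Theorems.SignedMuAtTwo
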